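import Literature.AlgebraicGeometry.Motives.HodgeSheaves
import Literature.AlgebraicGeometry.Modules.SheafHomFunctor
import Mathlib.LinearAlgebra.Alternating.Curry
import HarnessLib

/-!
# The wedge product `θ ∧ ω` on the Hodge sheaves: `∧ : Ωʲ_{X/S} → 𝓗om(Ω¹_{X/S}, Ωʲ⁺¹_{X/S})`

For a commutative ring `S` and an `S`-scheme `X : Over (Spec S)` the tree has the cotangent sheaf
`Ω¹_{X/S} = Motives.cotangentSheaf X` and the Hodge sheaves `Ωʲ_{X/S} = ⋀ʲ Ω¹_{X/S} = Motives.hodgeSheaf X j`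
(`Motives/HodgeSheaves.lean`: the sheafification of the presheaf `U ↦ ⋀ʲ_{𝒪(U)} Γ(U, Ω¹)`, which flags the
wedge product as "Not here"). This file CONSTRUCTS (no hypothesis structures, no named facts) the left
wedge with a `1`-form,

* `wedgeLeft R n : M →ₗ[R] ⋀ⁿ M →ₗ[R] ⋀ⁿ⁺¹ M`, `(θ, m₁ ∧ ⋯ ∧ mₙ) ↦ θ ∧ m₁ ∧ ⋯ ∧ mₙ` — pure algebra, from the
  universal property of `⋀ⁿ` (Mathlib `exteriorPower.alternatingMapLinearEquiv`) and the curried canonical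
  alternating map (`AlternatingMap.curryLeft`); `wedgeLeft_wedgeLeft : θ ∧ θ ∧ x = 0`;
  `wedgeLeftHom` — the same on `ModuleCat.exteriorPower`, and its compatibility
  `exteriorPowerMap'_wedgeLeftHom` with the maps induced by a SEMILINEAR map (the restriction maps of
  `⋀ⁿ` of a presheaf of modules, `Motives.exteriorPowerMap'`);
* `wedgeHom U ω : Ω¹|_U ⟶ Ωʲ⁺¹|_U` for `ω ∈ ⋀ʲ Γ(U, Ω¹)` — `θ ↦ θ ∧ ω|` computed sectionwise and pushed into
  the sheaf `Ωʲ⁺¹` along the sheafification map `toHodgeSheaf` (unit of Mathlib's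
  `PresheafOfModules.sheafificationAdjunction`), with its calculus (additive and `𝒪(U)`-linear in `ω`,
  compatible with restriction);
* `wedgePresheafHom X j : ⋀ʲ Γ(–, Ω¹) ⟶ 𝓗om(Ω¹, Ωʲ⁺¹)` and, by the sheafification adjunction,
  **`wedgeSheafHom X j : Ωʲ_{X/S} ⟶ 𝓗om(Ω¹_{X/S}, Ωʲ⁺¹_{X/S})`**, `ω ↦ (θ ↦ θ ∧ ω)`, a morphism of
  `𝒪_X`-modules (internal Hom of `Modules/SheafHom.lean`), with the defining triangle
  `wedgeSheafHom_app_toHodgeSheaf`.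

This is the exterior-algebra structure `Ω¹ ⊗ Ωʲ → Ωʲ⁺¹` on `Ω• = ⋀• Ω¹` (Hartshorne II Ex. 5.16: the
exterior algebra `⋀ ℱ` of a sheaf of modules is the sheaf associated to the sectionwise exterior algebras)
in the curried form that needs no tensor product of sheaves of modules (Mathlib has none at this pin). It is
the ingredient of the Yoneda powers `At(E)^q ∈ Ext^q(E, E ⊗ Ω^q)` of the Atiyah class and of the higher
Buchweitz–Flenner semiregularity components `σ_q` (`HodgeTheory/SemiregularityHigherSigma.lean`).

Design. All ring carriers are spelled through the presheaf of COMMUTATIVE rings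
`X.left.presheaf ⋙ forget₂ CommRingCat RingCat` (`formsOne`, `formsPresheaf`; definitionally the modules
underlying `cotangentSheaf X` and `Motives.exteriorPowerPresheaf`), because `ModuleCat.exteriorPower` wants a
`CommRing` instance on the ring of scalars. Sections of the sheafified `Ωʲ⁺¹` are never inspected: everything
about `Ωʲ⁺¹` goes through `toHodgeSheaf` and its naturality / linearity.

Not here: the full product `Ωᵃ ⊗ Ωᵇ → Ωᵃ⁺ᵇ` for `a ≥ 2`, associativity / graded commutativity, the de Rham
differential.

## References

* R. Hartshorne, *Algebraic Geometry* (1977), II Ex. 5.16 (tensor operations on sheaves of modules; the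
  exterior algebra `⋀ ℱ`). [Hartshorne1977]
-/
noncomputable section

open CategoryTheory AlgebraicGeometry Opposite TopologicalSpace

universe u

namespace Literature.AlgebraicGeometry.HodgeTheory

/-! ### The left wedge `θ ∧ –` on exterior powers of a module -/

section Algebra

variable (R : Type u) [CommRing R] {M : Type u} [AddCommGroup M] [Module R M] (n : ℕ)

/-- **Left wedge product with a vector**: the `R`-bilinear map `M × ⋀ⁿ M → ⋀ⁿ⁺¹ M`,
`(θ, m₁ ∧ ⋯ ∧ mₙ) ↦ θ ∧ m₁ ∧ ⋯ ∧ mₙ`, obtained from the universal property of `⋀ⁿ M`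
(Mathlib's `exteriorPower.alternatingMapLinearEquiv`) applied to the curried canonical
alternating map `ιMulti R (n+1)` (`AlternatingMap.curryLeft`). [folklore] -/
def wedgeLeft : M →ₗ[R] (⋀[R]^n M) →ₗ[R] (⋀[R]^(n + 1) M) :=
  (exteriorPower.alternatingMapLinearEquiv (R := R) (M := M) (N := ⋀[R]^(n + 1) M)
      (n := n)).toLinearMap ∘ₗ (exteriorPower.ιMulti R (n + 1)).curryLeft

/-- `θ ∧ (m₁ ∧ ⋯ ∧ mₙ) = θ ∧ m₁ ∧ ⋯ ∧ mₙ`. [folklore] -/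
@[simp]
lemma wedgeLeft_ιMulti (θ : M) (m : Fin n → M) :
    wedgeLeft R n θ (exteriorPower.ιMulti R n m) =
      exteriorPower.ιMulti R (n + 1) (Matrix.vecCons θ m) := by
  simp [wedgeLeft, AlternatingMap.curryLeft_apply_apply]

/-- `θ ∧ θ ∧ x = 0`. [folklore] -/
lemma wedgeLeft_wedgeLeft (θ : M) (x : ⋀[R]^n M) :
    wedgeLeft R (n + 1) θ (wedgeLeft R n θ x) = 0 := by
  have h : (wedgeLeft R (n + 1) θ ∘ₗ wedgeLeft R n θ) = 0 := by
    refine exteriorPower.linearMap_ext ?_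
    ext m
    simp only [LinearMap.compAlternatingMap_apply, LinearMap.coe_comp, Function.comp_apply,
      wedgeLeft_ιMulti, LinearMap.zero_apply]
    exact congrArg Subtype.val ((exteriorPower.ιMulti R (n + 1 + 1)).map_eq_zero_of_eq
      (Matrix.vecCons θ (Matrix.vecCons θ m)) (i := 0) (j := 1) (by simp) Fin.zero_ne_one)
  exact LinearMap.congr_fun h x

end Algebra

/-! ### The wedge on `ModuleCat` and its compatibility with a change of rings -/

section Semilinear

open Literature.AlgebraicGeometry.Motives

variable {A B : Type u} [CommRing A] [CommRing B] {φ : A →+* B}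
  {M : ModuleCat.{u} A} {N : ModuleCat.{u} B}

variable (M) in
/-- The left wedge `θ ∧ –` as a morphism `⋀ⁿ M ⟶ ⋀ⁿ⁺¹ M` in `ModuleCat A` (Mathlib's
`ModuleCat.exteriorPower`). [folklore] -/
def wedgeLeftHom (n : ℕ) (θ : M) : M.exteriorPower n ⟶ M.exteriorPower (n + 1) :=
  ModuleCat.ofHom (wedgeLeft A n θ)

/-- `wedgeLeftHom` on pure wedges. [folklore] -/
@[simp]
lemma wedgeLeftHom_mk {n : ℕ} (θ : M) (m : Fin n → M) :
    wedgeLeftHom M n θ (ModuleCat.exteriorPower.mk m) =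
      ModuleCat.exteriorPower.mk (Matrix.vecCons θ m) :=
  wedgeLeft_ιMulti A n θ m

/-- `wedgeLeftHom` is additive in `θ`. [folklore] -/
lemma wedgeLeftHom_add (n : ℕ) (θ θ' : M) (x : M.exteriorPower n) :
    wedgeLeftHom M n (θ + θ') x = wedgeLeftHom M n θ x + wedgeLeftHom M n θ' x := by
  change wedgeLeft A n (θ + θ') x = wedgeLeft A n θ x + wedgeLeft A n θ' x
  rw [map_add, LinearMap.add_apply]

/-- `wedgeLeftHom` is `A`-linear in `θ`. [folklore] -/
lemma wedgeLeftHom_smul (n : ℕ) (a : A) (θ : M) (x : M.exteriorPower n) :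
    wedgeLeftHom M n (a • θ) x = a • wedgeLeftHom M n θ x := by
  change wedgeLeft A n (a • θ) x = a • wedgeLeft A n θ x
  rw [map_smul, LinearMap.smul_apply]

/-- `0 ∧ x = 0`. [folklore] -/
@[simp]
lemma wedgeLeftHom_zero (n : ℕ) (x : M.exteriorPower n) : wedgeLeftHom M n (0 : M) x = 0 := by
  change wedgeLeft A n (0 : M) x = 0
  rw [map_zero, LinearMap.zero_apply]

/-- `θ ∧ θ ∧ x = 0` for `wedgeLeftHom`. [folklore] -/
lemma wedgeLeftHom_wedgeLeftHom (n : ℕ) (θ : M) (x : M.exteriorPower n) :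
    wedgeLeftHom M (n + 1) θ (wedgeLeftHom M n θ x) = 0 :=
  wedgeLeft_wedgeLeft A n θ x

/-- The maps induced on exterior powers by a semilinear map `g : M → N` (the tree's
`Motives.exteriorPowerMap'`, which gives the restriction maps of `⋀ⁿ` of a presheaf of modules)
commute with the left wedge: `g(θ ∧ x) = g(θ) ∧ g(x)`. [folklore] -/
lemma wedgeLeftHom_comp_exteriorPowerMap' (g : M ⟶ (ModuleCat.restrictScalars φ).obj N) (n : ℕ)
    (θ : M) :
    wedgeLeftHom M n θ ≫ exteriorPowerMap' g (n + 1) =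
      exteriorPowerMap' g n ≫ (ModuleCat.restrictScalars φ).map (wedgeLeftHom N n (g θ : N)) := by
  refine ModuleCat.exteriorPower.hom_ext ?_
  ext m
  simp only [ModuleCat.AlternatingMap.postcomp_apply]
  rw [ModuleCat.comp_apply, ModuleCat.comp_apply, wedgeLeftHom_mk, exteriorPowerMap'_mk,
    exteriorPowerMap'_mk, ModuleCat.restrictScalars.map_apply]
  erw [wedgeLeftHom_mk]
  congr 1
  funext i
  exact Fin.cases rfl (fun j => rfl) i

/-- Elementwise form of `wedgeLeftHom_comp_exteriorPowerMap'`. [folklore] -/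
lemma exteriorPowerMap'_wedgeLeftHom (g : M ⟶ (ModuleCat.restrictScalars φ).obj N) (n : ℕ)
    (θ : M) (x : M.exteriorPower n) :
    exteriorPowerMap' g (n + 1) (wedgeLeftHom M n θ x) =
      wedgeLeftHom N n (g θ : N) (exteriorPowerMap' g n x) := by
  rw [← ModuleCat.comp_apply, wedgeLeftHom_comp_exteriorPowerMap', ModuleCat.comp_apply,
    ModuleCat.restrictScalars.map_apply]

end Semilinear

/-! ### The wedge `θ ∧ –` on the Hodge sheaves `Ωʲ_{X/S} = ⋀ʲ Ω¹_{X/S}` -/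

section Sheaf

open Literature.AlgebraicGeometry.Modules Literature.AlgebraicGeometry.Motives

variable {S : Type u} [CommRing S] {X : Over (Spec (CommRingCat.of S))}

variable (X) in
/-- The presheaf of modules underlying `Ω¹_{X/S}`, typed over the presheaf of COMMUTATIVE rings
`𝒪_X` (so that the exterior powers `⋀ʲ_{𝒪(U)} Γ(U, Ω¹)` of its sections make sense). [folklore] -/
abbrev formsOne : PresheafOfModules.{u} (X.left.presheaf ⋙ forget₂ CommRingCat RingCat) :=
  (cotangentSheaf X).val

variable (X) in
/-- The presheaf of modules `U ↦ ⋀ʲ_{𝒪(U)} Γ(U, Ω¹_{X/S})` whose associated sheaf is the Hodge sheaf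
`Ωʲ_{X/S} = Motives.hodgeSheaf X j` (the tree's `Motives.exteriorPowerPresheaf` of the cotangent
sheaf). [folklore] -/
abbrev formsPresheaf (j : ℕ) : PresheafOfModules.{u} (X.left.presheaf ⋙ forget₂ CommRingCat RingCat) :=
  exteriorPowerPresheaf (formsOne X) j

variable (X) in
/-- The sheafification map `⋀ʲ Γ(–, Ω¹) → Ωʲ` (unit of Mathlib's sheafification adjunction for
presheaves of modules; `hodgeSheaf X j` IS the sheafification of `formsPresheaf X j`). [folklore] -/
def toHodgeSheaf (j : ℕ) :
    formsPresheaf X j ⟶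
      (PresheafOfModules.restrictScalars (𝟙 X.left.ringCatSheaf.obj)).obj (hodgeSheaf X j).val :=
  (PresheafOfModules.sheafificationAdjunction (𝟙 X.left.ringCatSheaf.obj)).unit.app
    (formsPresheaf X j)

/-- The restriction maps of `formsPresheaf` are the maps induced on exterior powers by the
restriction maps of `Ω¹` (`Motives.exteriorPowerMap'`). [folklore] -/
lemma formsPresheaf_map {U V : (X.left.Opens)ᵒᵖ} (i : U ⟶ V) (j : ℕ) :
    (formsPresheaf X j).map i = exteriorPowerMap' ((formsOne X).map i) j := rfl

variable {U V W : X.left.Opens} {j : ℕ}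

/-- The section-level wedge `θ ∧ ω|_W ∈ Γ(W, Ωʲ⁺¹)` of `θ ∈ Γ(W, Ω¹)` with the restriction of
`ω ∈ ⋀ʲ Γ(U, Ω¹)` along `k : W ⟶ U`. [folklore] -/
def wedgeSection (ω : (formsPresheaf X j).obj (op U)) (k : W ⟶ U) (θ : Γ(cotangentSheaf X, W)) :
    Γ(hodgeSheaf X (j + 1), W) :=
  (toHodgeSheaf X (j + 1)).app (op W)
    (wedgeLeftHom ((formsOne X).obj (op W)) j θ
      (((formsPresheaf X j).map k.op ω : (formsPresheaf X j).obj (op W))))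

/-- `wedgeSection` is additive in `θ`. [folklore] -/
lemma wedgeSection_add_right (ω : (formsPresheaf X j).obj (op U)) (k : W ⟶ U)
    (θ θ' : Γ(cotangentSheaf X, W)) :
    wedgeSection ω k (θ + θ') = wedgeSection ω k θ + wedgeSection ω k θ' := by
  rw [wedgeSection, wedgeSection, wedgeSection]
  erw [wedgeLeftHom_add, map_add]
  rfl

/-- `wedgeSection ω k 0 = 0`. [folklore] -/
@[simp]
lemma wedgeSection_zero_right (ω : (formsPresheaf X j).obj (op U)) (k : W ⟶ U) :
    wedgeSection ω k (0 : Γ(cotangentSheaf X, W)) = 0 := by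
  rw [wedgeSection]
  erw [wedgeLeftHom_zero, map_zero]
  rfl

/-- `wedgeSection` is `𝒪(W)`-linear in `θ`. [folklore] -/
lemma wedgeSection_smul_right (ω : (formsPresheaf X j).obj (op U)) (k : W ⟶ U)
    (a : Γ(X.left, W)) (θ : Γ(cotangentSheaf X, W)) :
    wedgeSection ω k (a • θ) = a • wedgeSection ω k θ := by
  rw [wedgeSection, wedgeSection]
  erw [wedgeLeftHom_smul]
  exact ((toHodgeSheaf X (j + 1)).app (op W)).hom.map_smul a _

/-- `wedgeSection` is additive in `ω`. [folklore] -/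
lemma wedgeSection_add_left (ω ω' : (formsPresheaf X j).obj (op U)) (k : W ⟶ U)
    (θ : Γ(cotangentSheaf X, W)) :
    wedgeSection (ω + ω') k θ = wedgeSection ω k θ + wedgeSection ω' k θ := by
  rw [wedgeSection, wedgeSection, wedgeSection]
  erw [map_add, map_add, map_add]
  rfl

/-- `wedgeSection` is `𝒪(U)`-linear in `ω`. [folklore] -/
lemma wedgeSection_smul_left (a : Γ(X.left, U)) (ω : (formsPresheaf X j).obj (op U)) (k : W ⟶ U)
    (θ : Γ(cotangentSheaf X, W)) :
    wedgeSection (a • ω) k θ = X.left.presheaf.map k.op a • wedgeSection ω k θ := by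
  rw [wedgeSection, wedgeSection]
  erw [PresheafOfModules.map_smul, map_smul]
  exact ((toHodgeSheaf X (j + 1)).app (op W)).hom.map_smul _ _

/-- `wedgeSection` only depends on `ω|_W`: restricting `ω` first gives the same section.
[folklore] -/
lemma wedgeSection_map (ω : (formsPresheaf X j).obj (op U)) (i : V ⟶ U) (k : W ⟶ V)
    (θ : Γ(cotangentSheaf X, W)) :
    wedgeSection ((formsPresheaf X j).map i.op ω : (formsPresheaf X j).obj (op V)) k θ =
      wedgeSection ω (k ≫ i) θ := by
  rw [wedgeSection, wedgeSection, ← PresheafOfModules.map_comp_apply]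
  rfl

/-- **Naturality of `wedgeSection` in `W`**: `(θ ∧ ω|_W)|_{W'} = θ|_{W'} ∧ ω|_{W'}`. [folklore] -/
lemma map_wedgeSection (ω : (formsPresheaf X j).obj (op U)) (k : W ⟶ U) (l : V ⟶ W)
    (θ : Γ(cotangentSheaf X, W)) :
    (hodgeSheaf X (j + 1)).val.map l.op (wedgeSection ω k θ) =
      wedgeSection ω (l ≫ k) ((cotangentSheaf X).val.map l.op θ) := by
  rw [wedgeSection, wedgeSection, op_comp, PresheafOfModules.map_comp_apply]
  change _ = (toHodgeSheaf X (j + 1)).app (op V) (wedgeLeftHom ((formsOne X).obj (op V)) j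
    ((formsOne X).map l.op θ) (exteriorPowerMap' ((formsOne X).map l.op) j
      (((formsPresheaf X j).map k.op ω : (formsPresheaf X j).obj (op W)))))
  rw [← exteriorPowerMap'_wedgeLeftHom, ← formsPresheaf_map]
  exact (PresheafOfModules.naturality_apply (toHodgeSheaf X (j + 1)) l.op _).symm

/-- **The wedge with a `j`-form over `U`**: for `ω ∈ ⋀ʲ Γ(U, Ω¹)` the morphism of restricted modules
`Ω¹|_U → Ωʲ⁺¹|_U`, `θ ↦ θ ∧ ω|` (computed in `⋀ʲ⁺¹ Γ(W, Ω¹)` and pushed to the sheaf `Ωʲ⁺¹` by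
`toHodgeSheaf`). [folklore] -/
def wedgeHom (U : X.left.Opens) (ω : (formsPresheaf X j).obj (op U)) :
    (cotangentSheaf X).over U ⟶ (hodgeSheaf X (j + 1)).over U where
  val := PresheafOfModules.homMk
    { app := fun V => AddCommGrpCat.ofHom
        { toFun := fun (θ : Γ(cotangentSheaf X, V.unop.left)) => wedgeSection ω V.unop.hom θ
          map_zero' := wedgeSection_zero_right ω V.unop.hom
          map_add' := wedgeSection_add_right ω V.unop.hom }
      naturality := fun {V V'} g => by
        refine AddCommGrpCat.ext fun (θ : Γ(cotangentSheaf X, V.unop.left)) => ?_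
        change wedgeSection ω V'.unop.hom ((cotangentSheaf X).val.map g.unop.left.op θ) =
          (hodgeSheaf X (j + 1)).val.map g.unop.left.op (wedgeSection ω V.unop.hom θ)
        rw [map_wedgeSection, Over.w] }
    (fun V (a : Γ(X.left, V.unop.left)) (θ : Γ(cotangentSheaf X, V.unop.left)) =>
      wedgeSection_smul_right ω V.unop.hom a θ)

/-- Values of `wedgeHom U ω`: `θ ↦ θ ∧ ω|_W` (pushed to `Ωʲ⁺¹`). [folklore] -/
@[simp]
lemma appLE_wedgeHom (ω : (formsPresheaf X j).obj (op U)) (k : W ⟶ U)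
    (θ : Γ(cotangentSheaf X, W)) :
    appLE (wedgeHom U ω) k θ = wedgeSection ω k θ :=
  rfl

/-- `wedgeHom` is additive in the form. [folklore] -/
lemma wedgeHom_add (ω ω' : (formsPresheaf X j).obj (op U)) :
    wedgeHom U (ω + ω') = wedgeHom U ω + wedgeHom U ω' :=
  hom_ext_of_appLE fun W k θ => by
    rw [appLE_add, appLE_wedgeHom, appLE_wedgeHom, appLE_wedgeHom, wedgeSection_add_left]

/-- `wedgeHom U 0 = 0`. [folklore] -/
@[simp]
lemma wedgeHom_zero (U : X.left.Opens) : wedgeHom U (0 : (formsPresheaf X j).obj (op U)) = 0 := by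
  have h := wedgeHom_add (0 : (formsPresheaf X j).obj (op U)) 0
  rw [add_zero] at h
  exact left_eq_add.mp h

/-- `wedgeHom` is `𝒪(U)`-linear in the form. [folklore] -/
lemma wedgeHom_smul (a : Γ(X.left, U)) (ω : (formsPresheaf X j).obj (op U)) :
    wedgeHom U (a • ω) = a • wedgeHom U ω :=
  hom_ext_of_appLE fun W k θ => by
    rw [appLE_smul, appLE_wedgeHom, appLE_wedgeHom, wedgeSection_smul_left]

/-- `wedgeHom` commutes with restriction. [folklore] -/
lemma restrictHom_wedgeHom (i : V ⟶ U) (ω : (formsPresheaf X j).obj (op U)) :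
    restrictHom i (wedgeHom U ω) =
      wedgeHom V ((formsPresheaf X j).map i.op ω : (formsPresheaf X j).obj (op V)) :=
  hom_ext_of_appLE fun W k θ => by
    rw [appLE_restrictHom, appLE_wedgeHom, appLE_wedgeHom, wedgeSection_map]

variable (X j) in
/-- The wedge as a morphism of presheaves of modules `⋀ʲ Γ(–, Ω¹) → 𝓗om(Ω¹, Ωʲ⁺¹)`,
`ω ↦ (θ ↦ θ ∧ ω)`. [folklore] -/
def wedgePresheafHom :
    formsPresheaf X j ⟶ (PresheafOfModules.restrictScalars (𝟙 X.left.ringCatSheaf.obj)).obj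
      (sheafHom (cotangentSheaf X) (hodgeSheaf X (j + 1))).val :=
  PresheafOfModules.homMk
    { app := fun U => AddCommGrpCat.ofHom
        { toFun := fun ω => (wedgeHom U.unop ω :
            (cotangentSheaf X).over U.unop ⟶ (hodgeSheaf X (j + 1)).over U.unop)
          map_zero' := wedgeHom_zero U.unop
          map_add' := wedgeHom_add }
      naturality := fun {U V} i => by
        refine AddCommGrpCat.ext fun (ω : (formsPresheaf X j).obj U) => ?_
        exact (restrictHom_wedgeHom i.unop ω).symm }
    (fun U (a : Γ(X.left, U.unop)) (ω : (formsPresheaf X j).obj U) => wedgeHom_smul a ω)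

/-- Components of `wedgePresheafHom`. [folklore] -/
@[simp]
lemma wedgePresheafHom_app_apply (U : X.left.Opens) (ω : (formsPresheaf X j).obj (op U)) :
    (wedgePresheafHom X j).app (op U) ω = wedgeHom U ω := rfl

variable (X j) in
/-- **The left wedge on the Hodge sheaves** `∧ : Ωʲ_{X/S} → 𝓗om(Ω¹_{X/S}, Ωʲ⁺¹_{X/S})`,
`ω ↦ (θ ↦ θ ∧ ω)` — the morphism of `𝒪_X`-modules induced (sheafification adjunction) by the wedge
product `Ω¹(U) × ⋀ʲ Ω¹(U) → ⋀ʲ⁺¹ Ω¹(U)` of the exterior algebra (Hartshorne II Ex. 5.16: the exterior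
algebra `⋀ ℱ` of a sheaf of modules, obtained by sheafifying the sectionwise exterior algebras).
[cite: Hartshorne1977, II Ex. 5.16] -/
def wedgeSheafHom : hodgeSheaf X j ⟶ sheafHom (cotangentSheaf X) (hodgeSheaf X (j + 1)) :=
  ((PresheafOfModules.sheafificationAdjunction (𝟙 X.left.ringCatSheaf.obj)).homEquiv _ _).symm
    (wedgePresheafHom X j)

/-- The defining triangle: after `toHodgeSheaf`, the sheaf wedge is `wedgePresheafHom`. [folklore] -/
lemma toHodgeSheaf_comp_wedgeSheafHom :
    toHodgeSheaf X j ≫ (PresheafOfModules.restrictScalars (𝟙 X.left.ringCatSheaf.obj)).map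
      (wedgeSheafHom X j).val = wedgePresheafHom X j := by
  change (PresheafOfModules.sheafificationAdjunction (𝟙 X.left.ringCatSheaf.obj)).homEquiv
    (formsPresheaf X j) (sheafHom (cotangentSheaf X) (hodgeSheaf X (j + 1))) (wedgeSheafHom X j) =
      wedgePresheafHom X j
  exact Equiv.apply_symm_apply _ _

/-- Elementwise form of the defining triangle: on (the image in `Ωʲ` of) a `j`-form
`ω ∈ ⋀ʲ Γ(U, Ω¹)` the sheaf wedge is `wedgeHom U ω = (θ ↦ θ ∧ ω)`. [folklore] -/
lemma wedgeSheafHom_app_toHodgeSheaf (ω : (formsPresheaf X j).obj (op U)) :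
    (wedgeSheafHom X j).val.app (op U) ((toHodgeSheaf X j).app (op U) ω) = wedgeHom U ω := by
  have h := congrArg (fun f => (PresheafOfModules.Hom.app f (op U)).hom ω)
    (toHodgeSheaf_comp_wedgeSheafHom (X := X) (j := j))
  exact h

end Sheaf

end Literature.AlgebraicGeometry.HodgeTheory

end
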